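import Summits.BirchSwinnertonDyer.BirchSwinnertonDyer.Theorems.GenusKolyvaginAtTwoPowDvdShaCardAtTwoRTPrimeSwapping
import HarnessLib

/-!
# Route `GenusKolyvaginAtTwo`, crux L_T `PowDvdShaCardAtTwoRT` (stmt-BirchSwinnertonDyer-23242), LINE 18 stub 3a⁗ —
# the BOTTOM RUNG at any depth: swapping a shallow prime of a `2`-PRIMITIVE Kolyvagin product for a deep one
# (McCallum Prop. 5.2 at `M_r = 0`, every arithmetic input displayed), and the loop oracle it yields

LEAD seat `bsd-line-gk2-p1` g15 (cell `bsd-f1-sign2`), `--supports stmt-BirchSwinnertonDyer-23242` (helper). Pure algebra over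
gk2-p2 g15's loop (`…RTPrimeSwapping`); THEOREMS ONLY. BSD is not proved by this file; neither is the crux or the stub.

WHY (memo `Cruxes/PowDvdShaCardAtTwoRT/Lines/plus-descent-lead-g15.md`, §3). L_T's hypothesis `hPn` is a SHALLOW witness: a
square-free product `n_w` of Kolyvagin primes of level `≥ 1` with `P_{n_w} ∉ 2E(K_{n_w})` (`m(n_w) = 0`). Kolyvagin's descent runs at a
HIGH uniform level `M`, so the primes of `n_w` must first be swapped, one at a time, for primes of level `≥ M` KEEPING `m = 0`. At the
bottom rung `M_r = 0` McCallum's auxiliary-class argument (proof of Prop. 5.2, (7)–(13)) is literally valid — all classes are of level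
`2`, the auxiliary class `u` (Prop. 2.1 / Lemma 5.3: Kummer off the primes of `n` and `λ₀`, TRANSVERSE at the primes of `n` other than
`ℓ₀`, free at `λ₀`) needs only to be locally NON-ZERO at the new prime — whereas at rungs with `M_r ≥ 1` it is void (memo §1) and
Kolyvagin's two-prime engine takes over (`…RTTwoPrimeSwap`). LINE 6 typed this step for `r = 1`
(`KolyvaginDescent.exists_deep_certificate_of_shallow`, p640533: there `n = ℓ₀`, no other own primes). This file is the same argument
for a product with ANY number of own primes: the two-place reciprocity now needs the terms at the OTHER own primes to vanish — both the
swapped Kolyvagin class `c_1(nℓ)` and `u` are TRANSVERSE there, and the transverse condition is isotropic (McCallum Lemma 5.3, last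
clause; at `2`: gk2-p3 g19 over `ℚ_ℓ`, the Hilbert symbol `(ℓ,−1)_{λ,2^M} = 1` over `K_λ`) — displayed as the hypothesis that the
reciprocity law holds for pairs lying, at every place off `{λ₀, λ}`, jointly in the Kummer OR jointly in the transverse condition.
The Čebotarev input is displayed in COMBINED form «a deep `ℓ ∉ S` at which the local term `⟨c_1(nℓ)_λ, u_λ⟩ ≠ 0` and which detects the
class `c`» (over `ℚ_ℓ` this is `c_1(n)_ℓ ≠ 0 ∧ u_ℓ ≠ 0` by the cyclic duality `lemma_5_3_rat_two`; over `K_λ` it is one bilinear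
Frobenius condition — the lost-bit law `…RTLostBitLaw` says an EIGEN `u` would not do, a generic one does).

* `exists_deep_swap_of_primitive` — one swap: from the displayed inputs, a deep `ℓ > b`, `ℓ ∉ S`, detecting `c`, with
  `c_1(n·ℓ/ℓ₀)_{λ₀} ≠ 0` — so `P_{nℓ/ℓ₀} ∉ 2E(K_{nℓ/ℓ₀})`: the new product is again `2`-primitive.
* `bottomOracle_of_primitive` — packaged as the `oracle` binder of gk2-p2's `exists_good_separating_of_swapOracle` with
  `good = Deep` and the invariant «`#S = r`, all primes Kolyvagin, `c_1(∏S) ≠ 0`»; with `C = ⊥` that loop is exactly the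
  level-raising of the `hPn` witness (all primes deep, still `2`-primitive): Kolyvagin's «strong non-zero system» at `2` DERIVED from
  `hPn` (Math. Ann. 291 (1991), (2.1) and Conj. 2.5), modulo the displayed inputs.

References: [McCallumLMS1991] §5 Prop. 5.2 (proof, (7)–(13)), Lemma 5.3, Prop. 4.4, Lemma 4.3, §2 Prop. 2.1, 2.2; [Kolyvagin1991MathAnn]
(2.1), Conj. 2.5; [WZhang2014] Lemma 8.2, (8.3)–(8.5); [GrossLMS1991] Prop. 6.2.
-/

set_option autoImplicit false
-- `Summit.<P>.<Sub>` repeats `BirchSwinnertonDyer` by the tree's layout convention (D-0017)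
set_option linter.dupNamespace false

namespace Summit.BirchSwinnertonDyer.BirchSwinnertonDyer.Theorems.GenusExact.PlusDescent

open Finset

section BottomRung

variable {U Y : Type*} [AddCommGroup U] [AddCommGroup Y] {Pl R : Type*} [AddCommGroup R]

/-- **The bottom-rung swap** (McCallum Prop. 5.2's replacement step at `M_r = 0`, for a product with any number of own primes).
Data on the level-`2` groups `U` (carrying the classes `uu S ℓ = c_1(∏S·ℓ)` and the auxiliary class `u`) and `Y` (carrying
`y S = c_1(∏S)`): places `pl`, deep primes `Deep`, Kummer conditions `LocU v`, transverse conditions `TrU v`, strict conditions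
`AU ℓ` / `AY ℓ` («the class vanishes at the place of `ℓ`»), strict conditions `A ℓ` on a third group `V` for the class `c` to be
detected, local pairings `π v`. Hypotheses (each a tree theorem or a displayed crux input, see the module docstring):
`hu` (the auxiliary class: Kummer off the places of `S`, transverse at the places of `S ∖ ℓ₀` — McCallum (8), (9)); `h43`/`htr`
(Lemma 4.3 and transversality of `c_1(nℓ)` at its own primes); `h44ord` (Prop. 4.4 at `λ₀`: `c_1(nℓ)_{λ₀} = 0 ⟺ c_1(nℓ/ℓ₀)_{λ₀} = 0`;
Prop. 4.4 at `λ` — `c_1(nℓ)` ramified at `λ ⟺ c_1(n)_λ ≠ 0` — is absorbed in the combined Čebotarev hypothesis below);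
`hrec` (Prop. 2.2 two-place form: if at every place off `{λ₀, λ}` the two classes are jointly Kummer or jointly transverse, the terms
at `λ₀` and `λ` add to `0` — isotropy of both conditions); `hstrict`; `hceb` (Čebotarev, combined form: a deep `ℓ > b` off `S` with
`⟨c_1(nℓ)_λ, u_λ⟩ ≠ 0` detecting `c`). Conclusion: a deep `ℓ > b`, `ℓ ∉ S`, detecting `c`, with `c_1(∏S·ℓ/ℓ₀)_{λ₀} ≠ 0`.
[cite: McCallumLMS1991, §5 Prop. 5.2 (proof, (7)–(13)), Lemma 5.3, Prop. 4.4] [cite: WZhang2014, (8.3)–(8.5)] -/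
theorem exists_deep_swap_of_primitive
    {V : Type*} [AddCommGroup V]
    (Deep : ℕ → Prop) (pl : ℕ → Pl)
    (LocU TrU : Pl → AddSubgroup U) (AU : ℕ → AddSubgroup U) (AY : ℕ → AddSubgroup Y) (A : ℕ → AddSubgroup V)
    (y : Finset ℕ → Y) (uu : Finset ℕ → ℕ → U) (π : Pl → U →+ U →+ R)
    (S : Finset ℕ) (ℓ₀ : ℕ) (u : U) (c : V)
    (hu : (∀ v, (∀ l ∈ S, v ≠ pl l) → u ∈ LocU v) ∧ ∀ l ∈ S, l ≠ ℓ₀ → u ∈ TrU (pl l))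
    (h43 : ∀ ℓ, Deep ℓ → ℓ ∉ S → ∀ v, (∀ l ∈ S, v ≠ pl l) → v ≠ pl ℓ → uu S ℓ ∈ LocU v)
    (htr : ∀ ℓ, Deep ℓ → ℓ ∉ S → ∀ l ∈ S, uu S ℓ ∈ TrU (pl l))
    (h44ord : ∀ ℓ, Deep ℓ → ℓ ∉ S → (uu S ℓ ∈ AU ℓ₀ ↔ y (insert ℓ (S.erase ℓ₀)) ∈ AY ℓ₀))
    (hrec : ∀ ℓ, Deep ℓ → ℓ ∉ S → ∀ a a' : U,
      (∀ v, v ≠ pl ℓ₀ → v ≠ pl ℓ → (a ∈ LocU v ∧ a' ∈ LocU v) ∨ (a ∈ TrU v ∧ a' ∈ TrU v)) →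
      π (pl ℓ₀) a a' + π (pl ℓ) a a' = 0)
    (hstrict : ∀ a a' : U, a ∈ AU ℓ₀ → π (pl ℓ₀) a a' = 0)
    (hceb : ∀ b : ℕ, ∃ ℓ, b < ℓ ∧ Deep ℓ ∧ ℓ ∉ S ∧ π (pl ℓ) (uu S ℓ) u ≠ 0 ∧ (c ≠ 0 → c ∉ A ℓ))
    (b : ℕ) :
    ∃ ℓ, b < ℓ ∧ Deep ℓ ∧ ℓ ∉ S ∧ (c ≠ 0 → c ∉ A ℓ) ∧ y (insert ℓ (S.erase ℓ₀)) ∉ AY ℓ₀ := by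
  obtain ⟨ℓ, hbℓ, hℓ, hℓS, hlam, hdet⟩ := hceb b
  refine ⟨ℓ, hbℓ, hℓ, hℓS, hdet, fun hw ↦ ?_⟩
  -- the two-place reciprocity applies to `(c_1(nℓ), u)`: off `{λ₀, λ}` both are Kummer (off the places of `S`) or both
  -- transverse (at the places of `S ∖ ℓ₀`)
  have hsum := hrec ℓ hℓ hℓS (uu S ℓ) u (fun v hv₀ hvℓ ↦ by
    by_cases hS : ∀ l ∈ S, v ≠ pl l
    · exact Or.inl ⟨h43 ℓ hℓ hℓS v hS hvℓ, hu.1 v hS⟩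
    · push Not at hS
      obtain ⟨l, hlS, rfl⟩ := hS
      have hl0 : l ≠ ℓ₀ := fun h ↦ hv₀ (by rw [h])
      exact Or.inr ⟨htr ℓ hℓ hℓS l hlS, hu.2 l hlS hl0⟩)
  -- the `λ`-term is non-zero (Čebotarev choice), hence so is the `λ₀`-term
  have hlam0 : π (pl ℓ₀) (uu S ℓ) u ≠ 0 := fun h0 ↦ hlam (by rwa [h0, zero_add] at hsum)
  -- so `c_1(nℓ)_{λ₀} ≠ 0`, i.e. (Prop. 4.4 at `λ₀`) `c_1(nℓ/ℓ₀)_{λ₀} ≠ 0`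
  have ha₀ : uu S ℓ ∉ AU ℓ₀ := fun h ↦ hlam0 (hstrict _ _ h)
  exact ha₀ ((h44ord ℓ hℓ hℓS).mpr hw)

/-- **The loop oracle at the bottom rung.** With the invariant `Inv S := #S = r ∧ (∀ l ∈ S, kol l) ∧ c_1(∏S) ≠ 0` («a square-free
product of `r` Kolyvagin primes at `2` which is `2`-PRIMITIVE», i.e. `m(∏S) = 0 = M_r`), `good := Deep`, and the bottom-rung swap
available for every admissible `S`, every `ℓ₀ ∈ S` and every `c ∈ Cp` with SOME auxiliary class `u` (hypothesis `hstep`, =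
`exists_deep_swap_of_primitive` with its inputs supplied; the auxiliary class is Prop. 2.1's), plus `hdeepkol` (deep primes are
Kolyvagin primes) and `hAY0` (`0 ∈` every strict condition, so `c_1(n′)_{λ₀} ≠ 0 ⟹ c_1(n′) ≠ 0`): the `oracle` binder of gk2-p2's
`exists_good_separating_of_swapOracle`. With `C = ⊥` that loop then raises the `hPn` witness to any level keeping it `2`-primitive
(Kolyvagin's strong non-zero system at `2`, derived). [cite: McCallumLMS1991, §5 Prop. 5.2 (proof)] [cite: Kolyvagin1991MathAnn, (2.1), Conj. 2.5] -/
theorem bottomOracle_of_primitive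
    {V : Type*} [AddCommGroup V]
    (Deep kol : ℕ → Prop) (AY : ℕ → AddSubgroup Y) (A : ℕ → AddSubgroup V) (Cp : AddSubgroup V)
    (y : Finset ℕ → Y) (r : ℕ)
    (hdeepkol : ∀ ℓ, Deep ℓ → kol ℓ)
    (hstep : ∀ S : Finset ℕ, S.card = r → (∀ l ∈ S, kol l) → y S ≠ 0 → ∀ ℓ₀ ∈ S, ∀ c ∈ Cp, ∀ b : ℕ,
      ∃ ℓ, b < ℓ ∧ Deep ℓ ∧ ℓ ∉ S ∧ (c ≠ 0 → c ∉ A ℓ) ∧ y (insert ℓ (S.erase ℓ₀)) ∉ AY ℓ₀) :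
    ∀ S, (S.card = r ∧ (∀ l ∈ S, kol l) ∧ y S ≠ 0) → ∀ ℓ₀ ∈ S, ∀ c ∈ Cp,
      ∃ ℓ', ℓ' ∉ S ∧ Deep ℓ' ∧
        ((insert ℓ' (S.erase ℓ₀)).card = r ∧ (∀ l ∈ insert ℓ' (S.erase ℓ₀), kol l) ∧ y (insert ℓ' (S.erase ℓ₀)) ≠ 0) ∧
        (c ≠ 0 → c ∉ A ℓ') := by
  classical
  rintro S ⟨hcard, hkol, hy⟩ ℓ₀ hℓ₀ c hc
  obtain ⟨ℓ, -, hℓ, hℓS, hdet, hy0⟩ := hstep S hcard hkol hy ℓ₀ hℓ₀ c hc 0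
  refine ⟨ℓ, hℓS, hℓ, ⟨?_, ?_, fun h0 ↦ hy0 (by rw [h0]; exact (AY ℓ₀).zero_mem)⟩, hdet⟩
  · rw [Finset.card_insert_of_notMem (fun h ↦ hℓS (Finset.mem_of_mem_erase h)), Finset.card_erase_of_mem hℓ₀, hcard]
    have : 0 < S.card := Finset.card_pos.mpr ⟨ℓ₀, hℓ₀⟩
    omega
  · intro l hl
    rcases Finset.mem_insert.mp hl with rfl | hl
    · exact hdeepkol _ hℓ
    · exact hkol l (Finset.mem_of_mem_erase hl)

/-- **Level-raising of the shallow witness** (Kolyvagin's strong non-zero system at `2` from `hPn`, modulo the displayed inputs):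
from a `2`-primitive square-free product `S₀` of `r` Kolyvagin primes and the bottom-rung swap (`hstep`), a `2`-primitive square-free
product of `r` DEEP Kolyvagin primes — gk2-p2's loop `exists_good_separating_of_swapOracle` with nothing to separate (`C = ⊥`).
[cite: Kolyvagin1991MathAnn, (2.1), Conj. 2.5, Thm. 2.2 (proof: «replace p′_1,…,p′_f by p_1,…,p_f»)] [cite: McCallumLMS1991, §5 Prop. 5.2] -/
theorem exists_deep_primitive_of_shallow
    {V : Type*} [AddCommGroup V] {p M : ℕ} (hp : p.Prime) (hV : ∀ v : V, p ^ M • v = 0)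
    (Deep kol : ℕ → Prop) (AY : ℕ → AddSubgroup Y) (A : ℕ → AddSubgroup V)
    (y : Finset ℕ → Y) (r : ℕ)
    (hdeepkol : ∀ ℓ, Deep ℓ → kol ℓ)
    (hstep : ∀ S : Finset ℕ, S.card = r → (∀ l ∈ S, kol l) → y S ≠ 0 → ∀ ℓ₀ ∈ S, ∀ c ∈ (⊥ : AddSubgroup V), ∀ b : ℕ,
      ∃ ℓ, b < ℓ ∧ Deep ℓ ∧ ℓ ∉ S ∧ (c ≠ 0 → c ∉ A ℓ) ∧ y (insert ℓ (S.erase ℓ₀)) ∉ AY ℓ₀)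
    (S₀ : Finset ℕ) (hS₀ : S₀.card = r ∧ (∀ l ∈ S₀, kol l) ∧ y S₀ ≠ 0) :
    ∃ S : Finset ℕ, (S.card = r ∧ (∀ l ∈ S, kol l) ∧ y S ≠ 0) ∧ ∀ l ∈ S, Deep l := by
  classical
  haveI : Finite (⊥ : AddSubgroup V) := Finite.of_subsingleton
  have hd : Nat.card ↥((⊥ : AddSubgroup V) ⊓ AddSubgroup.torsionBy V (p : ℤ)) = p ^ 0 := by
    rw [bot_inf_eq, pow_zero, AddSubgroup.card_bot]
  have hK : ∀ l, Deep l → (A l).relIndex ((⊥ : AddSubgroup V) ⊓ AddSubgroup.torsionBy V (p : ℤ)) ∣ p := fun l _ ↦ by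
    rw [bot_inf_eq, AddSubgroup.relIndex_bot_right]
    exact one_dvd p
  obtain ⟨S, hS, hgood, -⟩ := exists_good_separating_of_swapOracle hp hV (⊥ : AddSubgroup V) hd (Nat.zero_le r) A Deep
    (fun S ↦ S.card = r ∧ (∀ l ∈ S, kol l) ∧ y S ≠ 0) (fun S hS ↦ hS.1) hK S₀ hS₀
    (bottomOracle_of_primitive Deep kol AY A ((⊥ : AddSubgroup V) ⊓ AddSubgroup.torsionBy V (p : ℤ)) y r hdeepkol
      (fun S hc hk hy ℓ₀ hℓ₀ c hc' b ↦ hstep S hc hk hy ℓ₀ hℓ₀ c (AddSubgroup.mem_inf.mp hc').1 b))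
  exact ⟨S, hS, hgood⟩

end BottomRung

end Summit.BirchSwinnertonDyer.BirchSwinnertonDyer.Theorems.GenusExact.PlusDescent
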